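import Summits.ResolutionOfSingularities.ResolutionOfSingularities.Theorems.HilbertSamuelEliminationCampaignW54SingInRidge
import Literature.AlgebraicGeometry.Resolution.MonomialCurveEmbeddingDimension
import Literature.AlgebraicGeometry.Resolution.RegularLocalRingsJacobian
import Mathlib.AlgebraicGeometry.Morphisms.Smooth
import Mathlib.RingTheory.RingHom.Smooth
import Mathlib.RingTheory.Smooth.Basic
import Mathlib.Algebra.Polynomial.Roots
import Mathlib.FieldTheory.IsAlgClosed.AlgebraicClosure

/-!
# [OURS · L1 W5.4 · kill test K5.4] The W-Q origins refute `CampaignW54.RegularEnclosureAt` (scheme level)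

Cell `res-hironaka`, rung L, kill test K5.4 of slot W5.4 (verdict DEAD, HOME/STATUS 2026-08-26T20:33:11Z; director
ruling 20:38:08Z asked for this kernel instance); seat `res-L1-k54`; host door `HilbertSamuelElimination` /
`RidgeConfinement` (stmt-ResolutionOfSingularities-17845). NOTHING here is a statement of H. Hironaka's manuscript
(2017); the pairs are the cell's OURS witnesses (`…Hironaka2017.WQWitness.fW`, `…WQ3Witness.f`), the predicates the
cell's OURS campaign predicates (typer o5, p465201), and the conclusion refutes an OURS statement only.

Argument (all in the kernel), for `Z = Spec K[x]`, `K` an INFINITE field of characteristic `p`, `E = ((f), 2)`: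
(1) `f(γ(t)) = (∂_i f)(γ(t)) = 0` for all `t` (even resp. multiple-of-3 coefficients), so `f ∈ 𝔞_{γ(t)}²` by the
first-order Taylor step (`Resolution.mem_ker_eval_sq_of_pderiv_eval_eq_zero`) and `γ(t) ∈ Sing(E)` (stalks on `Spec`:
`Spec.stalkIso`, `Localization.AtPrime.map_eq_maximalIdeal`); (2) a global section of the reduced ideal of
`Sing(E)` vanishes at every `γ(t)`, hence on `γ` (`Polynomial.zero_of_eval_zero`, `K` infinite), hence lies in `𝔪₀²`
(embedding dimension: tree `WQ5/WQ4.mem_idealOfVars_sq`, Herzog 1970) — `I(Sing(E)_red)₀ ≤ 𝔪₀²`; (3) o5's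
`not_regularEnclosureAt_of_le_sq`, and for the global statement the affine ambient datum `Spec K[x] → Spec K` over
`K = 𝔽̄_p` with the closed point `0 ∈ Sing(E)`. For `p = 3` the exponent `2` (locus `{ord ≥ 2} ⊇ {ord ≥ 3} ⊇ γ`) is
used; the W-Q pair's exponent `3` would need the second-order Taylor step (not formalised).
References (orientation): J. Herzog, Manuscripta Math. 3 (1970); R. Hartshorne, GTM 52, I Thm 5.1.
-/

noncomputable section

set_option linter.dupNamespace false -- mandated namespace of this single-conjunct summit

open _root_.CategoryTheory _root_.AlgebraicGeometry _root_.TopologicalSpace IsLocalRing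
open Literature.AlgebraicGeometry Literature.AlgebraicGeometry.Resolution
open Literature.AlgebraicGeometry.Hironaka2017.S02Preliminaries
open _root_.AlgebraicGeometry.Scheme.IdealSheafData
open MvPolynomial

namespace Summit.ResolutionOfSingularities.ResolutionOfSingularities.Theorems

universe u

namespace K54WQRefutation

/-! ## §1 Algebra: the W-Q hypersurfaces have order `≥ 2` at every point of their curve -/
section Algebra

variable {K : Type u} [CommRing K]

/-- Evaluation at `γ(t)` factors through the parametrisation `X_i ↦ T^{w_i}`:
`F(γ(t)) = (F ∘ γ)(t)`. [folklore] -/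
theorem eval_curvePt {n : ℕ} (w : Fin n → ℕ) (t : K) (F : MvPolynomial (Fin n) K) :
    eval ((fun i => t ^ w i)) F = Polynomial.eval t (monomialCurve w F) := by
  induction F using MvPolynomial.induction_on with
  | C c => simp [monomialCurve]
  | add p q hp hq => simp [hp, hq]
  | mul_X p j hp => simp [hp, monomialCurve]

/-- Over an infinite domain: a polynomial vanishing at every `γ(t)` has `F ∘ γ = 0` in `K[T]`. [folklore] -/
theorem monomialCurve_eq_zero_of_forall_eval [IsDomain K] [Infinite K] {n : ℕ} (w : Fin n → ℕ)
    {F : MvPolynomial (Fin n) K} (h : ∀ t : K, eval ((fun i => t ^ w i)) F = 0) : monomialCurve w F = 0 :=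
  Polynomial.zero_of_eval_zero _ fun t => by rw [← eval_curvePt, h]

/-- `γ(0) = 0` for positive exponents. [folklore] -/
theorem curvePt_zero {n : ℕ} (w : Fin n → ℕ) (hw : ∀ i, w i ≠ 0) : (fun i => (0 : K) ^ w i) = 0 := by
  funext i
  simp [zero_pow (hw i)]

/-- W5 (`p = 2`): `fW(γ(t)) = 0` for every `t` (`fW(γ(T)) = 8·T¹⁹⁸`). [folklore] -/
theorem WQ5.eval_curvePt_fW [CharP K 2] (t : K) :
    eval ((fun i => t ^ WQ5.w i)) (Hironaka2017.WQWitness.fW (R := K)) = 0 := by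
  rw [eval_curvePt, WQ5.monomialCurve_fW_char2 (CharTwo.two_eq_zero (R := K)), Polynomial.eval_zero]

/-- W5: all first partials of `fW` vanish along `γ` (even multiples of powers of `T`). [folklore] -/
theorem WQ5.eval_curvePt_pderiv_fW [CharP K 2] (t : K) (i : Fin 5) :
    eval ((fun i => t ^ WQ5.w i)) (pderiv i (Hironaka2017.WQWitness.fW (R := K))) = 0 := by
  fin_cases i <;>
  · simp [Hironaka2017.WQWitness.fW, WQ5.w]
    ring_nf
    reduce_mod_char!

/-- W5: `fW ∈ 𝔞_{γ(t)}²` — the hypersurface `fW = 0` has order `≥ 2` at every point of `γ`. [folklore] -/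
theorem WQ5.fW_mem_ker_eval_sq [CharP K 2] (t : K) :
    (Hironaka2017.WQWitness.fW (R := K)) ∈ RingHom.ker (eval ((fun i => t ^ WQ5.w i))) ^ 2 :=
  mem_ker_eval_sq_of_pderiv_eval_eq_zero _ (WQ5.eval_curvePt_fW t) (WQ5.eval_curvePt_pderiv_fW t)

/-- W4 (`p = 3`): `f(γ(s)) = 0` for every `s` (`f(γ(S)) = 9·S¹²³`). [folklore] -/
theorem WQ4.eval_curvePt_f [CharP K 3] (t : K) :
    eval ((fun i => t ^ WQ4.w i)) (Hironaka2017.WQ3Witness.f (R := K)) = 0 := by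
  have h3 : (3 : K) = 0 := by exact_mod_cast CharP.cast_eq_zero K 3
  rw [eval_curvePt, WQ4.monomialCurve_f_char3 h3, Polynomial.eval_zero]

/-- W4: all first partials of `f` vanish along `γ` (multiples of `3` times powers of `S`). [folklore] -/
theorem WQ4.eval_curvePt_pderiv_f [CharP K 3] (t : K) (i : Fin 4) :
    eval ((fun i => t ^ WQ4.w i)) (pderiv i (Hironaka2017.WQ3Witness.f (R := K))) = 0 := by
  fin_cases i <;>
  · simp [Hironaka2017.WQ3Witness.f, Hironaka2017.WQ3Witness.G, WQ4.w]
    ring_nf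
    reduce_mod_char!

/-- W4: `f ∈ 𝔞_{γ(s)}²`. [folklore] -/
theorem WQ4.f_mem_ker_eval_sq [CharP K 3] (t : K) :
    (Hironaka2017.WQ3Witness.f (R := K)) ∈ RingHom.ker (eval ((fun i => t ^ WQ4.w i))) ^ 2 :=
  mem_ker_eval_sq_of_pderiv_eval_eq_zero _ (WQ4.eval_curvePt_f t) (WQ4.eval_curvePt_pderiv_f t)

/-- `𝔪₀ = (x_i : i) ≤ 𝔞_0 = ker (eval 0)` (in fact equal). [folklore] -/
theorem idealOfVars_le_ker_eval_zero {n : ℕ} :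
    idealOfVars (Fin n) K ≤ RingHom.ker (eval (0 : Fin n → K)) := by
  refine Ideal.span_le.mpr ?_
  rintro _ ⟨i, rfl⟩
  simp [RingHom.mem_ker]

end Algebra

/-! ## §2 Plumbing on `Spec R`: germs of global sections, stalks of ideal sheaves, vanishing ideals -/
section SpecPlumbing

variable (R : CommRingCat.{u})

/-- On `Spec R`: if the element `r ∈ R` corresponding to a global section `s` lies in `𝔭^n`, then the germ of `s`
at `𝔭` lies in `𝔪_𝔭^n` (the stalk is `R_𝔭`; Mathlib `Spec.stalkIso`, `Localization.AtPrime.map_eq_maximalIdeal`).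
[folklore] -/
theorem germ_mem_maximalIdeal_pow (x : Spec R) (n : ℕ) (s : Γ(Spec R, ⊤))
    (hs : (Scheme.ΓSpecIso R).hom s ∈ x.asIdeal ^ n) :
    (Spec R).presheaf.germ ⊤ x trivial s ∈ maximalIdeal ((Spec R).presheaf.stalk x) ^ n := by
  set L := Localization.AtPrime x.asIdeal with hL
  -- the image of the germ in `R_𝔭` is `algebraMap (ι s)`
  have h1 : (Spec.stalkIso R x).hom ((Spec R).presheaf.germ ⊤ x trivial s) =
      algebraMap R L ((Scheme.ΓSpecIso R).hom s) := by
    change ((Spec R).presheaf.germ ⊤ x trivial ≫ (Spec.stalkIso R x).hom) s = _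
    rw [Spec.germ_stalkMapIso_hom]
    rfl
  -- membership in `R_𝔭`
  have h2 : algebraMap R L ((Scheme.ΓSpecIso R).hom s) ∈ maximalIdeal L ^ n := by
    rw [← Localization.AtPrime.map_eq_maximalIdeal, ← Ideal.map_pow]
    exact Ideal.mem_map_of_mem _ hs
  -- transport back along the iso
  set φ := (Spec.stalkIso R x).hom with hφ
  set ψ := (Spec.stalkIso R x).inv with hψ
  have hψφ : ∀ y, ψ (φ y) = y := fun y => by
    change (φ ≫ ψ) y = y
    rw [hφ, hψ, Iso.hom_inv_id]; rfl
  have hφψ : ∀ z, φ (ψ z) = z := fun z => by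
    change (ψ ≫ φ) z = z
    rw [hφ, hψ, Iso.inv_hom_id]; rfl
  have hloc : Ideal.map ψ.hom (maximalIdeal L) ≤ maximalIdeal ((Spec R).presheaf.stalk x) := by
    rw [Ideal.map_le_iff_le_comap]
    intro z hz
    rw [Ideal.mem_comap, IsLocalRing.mem_maximalIdeal, mem_nonunits_iff]
    intro hu
    have hu' : IsUnit (φ.hom (ψ.hom z)) := hu.map φ.hom
    have : φ.hom (ψ.hom z) = z := hφψ z
    rw [this] at hu'
    exact (IsLocalRing.mem_maximalIdeal _ |>.mp hz) hu'
  have h3 : ψ (φ ((Spec R).presheaf.germ ⊤ x trivial s)) ∈ maximalIdeal ((Spec R).presheaf.stalk x) ^ n := by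
    rw [h1]
    have hm : ψ.hom (algebraMap R L ((Scheme.ΓSpecIso R).hom s)) ∈ Ideal.map ψ.hom (maximalIdeal L ^ n) :=
      Ideal.mem_map_of_mem _ h2
    rw [Ideal.map_pow] at hm
    exact Ideal.pow_right_mono hloc n hm
  rwa [hψφ] at h3

/-- On `Spec R`: the stalk at `𝔭` of the ideal sheaf of an ideal `I ⊆ R` (transported to the global sections) lies
in `𝔪_𝔭^n` as soon as `I ≤ 𝔭^n`. [folklore] -/
theorem stalkIdeal_ofIdealTop_le_pow (x : Spec R) (n : ℕ) (I : Ideal R) (hI : I ≤ x.asIdeal ^ n) :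
    stalkIdeal (ofIdealTop (I.map (Scheme.ΓSpecIso R).inv.hom)) x ≤
      maximalIdeal ((Spec R).presheaf.stalk x) ^ n := by
  rw [stalkIdeal_eq_map_germ _ ⟨⊤, isAffineOpen_top (Spec R)⟩ trivial, ofIdealTop_ideal, Ideal.map_le_iff_le_comap,
    Ideal.map_le_iff_le_comap]
  intro s hs
  rw [Ideal.mem_comap, Ideal.mem_comap]
  rw [Ideal.mem_map_iff_of_surjective _ (ConcreteCategory.bijective_of_isIso (Scheme.ΓSpecIso R).inv).2] at hs
  obtain ⟨r, hr, rfl⟩ := hs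
  -- the restriction map `⊤ ≤ ⊤` is the identity
  have hid : (Spec R).presheaf.map (homOfLE (le_top : (⊤ : (Spec R).Opens) ≤ ⊤)).op = 𝟙 _ := by
    have : homOfLE (le_top : (⊤ : (Spec R).Opens) ≤ ⊤) = 𝟙 _ := Subsingleton.elim _ _
    rw [this, op_id, CategoryTheory.Functor.map_id]
  rw [hid]
  change (Spec R).presheaf.germ ⊤ x trivial ((Scheme.ΓSpecIso R).inv r) ∈ _
  apply germ_mem_maximalIdeal_pow
  have : (Scheme.ΓSpecIso R).hom ((Scheme.ΓSpecIso R).inv r) = r := by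
    change ((Scheme.ΓSpecIso R).inv ≫ (Scheme.ΓSpecIso R).hom) r = r
    rw [Iso.inv_hom_id]; rfl
  rw [this]
  exact hI hr

/-- On `Spec R`: a global section of the vanishing ideal sheaf of a closed set `Z` vanishes (as an element of `R`)
at every point of `Z`. [folklore] -/
theorem mem_asIdeal_of_mem_vanishingIdeal (Z : Closeds (Spec R)) (s : Γ(Spec R, ⊤))
    (hs : s ∈ (vanishingIdeal Z).ideal ⟨⊤, isAffineOpen_top (Spec R)⟩) (P : Spec R) (hP : P ∈ Z) :
    (Scheme.ΓSpecIso R).hom s ∈ P.asIdeal := by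
  rw [vanishingIdeal_ideal, PrimeSpectrum.mem_vanishingIdeal] at hs
  have hfrom : (isAffineOpen_top (Spec R)).fromSpec (Spec.map (Scheme.ΓSpecIso R).hom P) = P := by
    rw [IsAffineOpen.fromSpec_top, Scheme.isoSpec_Spec_inv, ← Scheme.Hom.comp_apply, ← Spec.map_comp,
      Iso.inv_hom_id, Spec.map_id]
    rfl
  have h := hs (Spec.map (Scheme.ΓSpecIso R).hom P) (by
    change (isAffineOpen_top (Spec R)).fromSpec (Spec.map (Scheme.ΓSpecIso R).hom P) ∈ (Z : Set (Spec R))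
    rw [hfrom]; exact hP)
  rw [Spec.map_apply] at h
  exact h

end SpecPlumbing

/-! ## §3 The refutation: hypersurface pairs `((f), b)` on `Spec K[x]` whose top locus contains a monomial curve of
full embedding dimension through the origin -/
section Assembly

variable (K : Type u) [Field K] {n : ℕ}

variable {K}

/-- If `f ∈ 𝔞_{γ(t)}^b` then `γ(t) ∈ Sing((f), b)` (`ord_{γ(t)} (f) ≥ b`). [folklore] -/
theorem curvePoint_mem_sing (w : Fin n → ℕ) (f : MvPolynomial (Fin n) K) (b : ℕ)
    (hf : ∀ t : K, f ∈ RingHom.ker (eval ((fun i => t ^ w i))) ^ b) (t : K) :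
    (⟨RingHom.ker (eval fun i => t ^ w i), RingHom.ker_isPrime _⟩ : Spec (CommRingCat.of (MvPolynomial (Fin n) K))) ∈ (⟨ofIdealTop ((Ideal.span {f}).map (Scheme.ΓSpecIso (CommRingCat.of (MvPolynomial (Fin n) K))).inv.hom), b⟩ :
      IdealExponent (Spec (CommRingCat.of (MvPolynomial (Fin n) K)))).sing := by
  change (b : ℕ∞) ≤ idealOrder (⟨ofIdealTop ((Ideal.span {f}).map (Scheme.ΓSpecIso (CommRingCat.of (MvPolynomial (Fin n) K))).inv.hom), b⟩ :
      IdealExponent (Spec (CommRingCat.of (MvPolynomial (Fin n) K)))).J (⟨RingHom.ker (eval fun i => t ^ w i), RingHom.ker_isPrime _⟩ : Spec (CommRingCat.of (MvPolynomial (Fin n) K)))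
  rw [le_idealOrder_iff]
  refine stalkIdeal_ofIdealTop_le_pow _ (⟨RingHom.ker (eval fun i => t ^ w i), RingHom.ker_isPrime _⟩ : Spec (CommRingCat.of (MvPolynomial (Fin n) K))) b (Ideal.span {f}) ?_
  rw [Ideal.span_le, Set.singleton_subset_iff]
  exact hf t

/-- **The mechanism.** If `f ∈ 𝔞_{γ(t)}^b` for every `t` (the curve `γ` lies in `Sing((f), b)`), `K` is infinite,
and every polynomial vanishing on `γ` lies in `𝔪₀²` (embedding dimension of `γ` at `0` is `n`), then the stalk at
the origin of the reduced ideal of `Sing((f), b)` lies in `𝔪₀²`. [folklore] -/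
theorem singIdealAt_le_sq [Infinite K] (w : Fin n → ℕ) (hw : ∀ i, w i ≠ 0)
    (f : MvPolynomial (Fin n) K) (b : ℕ) (hf : ∀ t : K, f ∈ RingHom.ker (eval ((fun i => t ^ w i))) ^ b)
    (hM : ∀ F : MvPolynomial (Fin n) K, monomialCurve w F = 0 → F ∈ idealOfVars (Fin n) K ^ 2) :
    CampaignW54.singIdealAt (⟨ofIdealTop ((Ideal.span {f}).map (Scheme.ΓSpecIso (CommRingCat.of (MvPolynomial (Fin n) K))).inv.hom), b⟩ :
      IdealExponent (Spec (CommRingCat.of (MvPolynomial (Fin n) K)))) (⟨RingHom.ker (eval fun i => (0 : K) ^ w i), RingHom.ker_isPrime _⟩ : Spec (CommRingCat.of (MvPolynomial (Fin n) K))) ≤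
      maximalIdeal ((Spec (CommRingCat.of (MvPolynomial (Fin n) K))).presheaf.stalk (⟨RingHom.ker (eval fun i => (0 : K) ^ w i), RingHom.ker_isPrime _⟩ : Spec (CommRingCat.of (MvPolynomial (Fin n) K)))) ^ 2 := by
  unfold CampaignW54.singIdealAt
  rw [stalkIdeal_eq_map_germ _ ⟨⊤, isAffineOpen_top _⟩ trivial, Ideal.map_le_iff_le_comap]
  intro s hs
  rw [Ideal.mem_comap]
  apply germ_mem_maximalIdeal_pow
  have hvan : ∀ t : K, eval ((fun i => t ^ w i))
      ((Scheme.ΓSpecIso (CommRingCat.of (MvPolynomial (Fin n) K))).hom s) = 0 := fun t =>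
    mem_asIdeal_of_mem_vanishingIdeal _ (CampaignW54.singClosure
      (⟨ofIdealTop ((Ideal.span {f}).map (Scheme.ΓSpecIso (CommRingCat.of (MvPolynomial (Fin n) K))).inv.hom), b⟩ :
      IdealExponent (Spec (CommRingCat.of (MvPolynomial (Fin n) K))))) s hs (⟨RingHom.ker (eval fun i => t ^ w i), RingHom.ker_isPrime _⟩ : Spec (CommRingCat.of (MvPolynomial (Fin n) K)))
      (subset_closure (curvePoint_mem_sing w f b hf t))
  have h2 := hM _ (monomialCurve_eq_zero_of_forall_eval w hvan)
  have hle : idealOfVars (Fin n) K ≤ (⟨RingHom.ker (eval fun i => (0 : K) ^ w i), RingHom.ker_isPrime _⟩ : Spec (CommRingCat.of (MvPolynomial (Fin n) K))).asIdeal := by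
    change idealOfVars (Fin n) K ≤ RingHom.ker (eval ((fun i => (0 : K) ^ w i)))
    rw [curvePt_zero w hw]
    exact idealOfVars_le_ker_eval_zero
  exact Ideal.pow_right_mono hle 2 h2

/-- **No regular enclosure at the origin** under the hypotheses of `singIdealAt_le_sq`
(via o5's `CampaignW54.not_regularEnclosureAt_of_le_sq`). [folklore] -/
theorem not_regularEnclosureAt_of_curve [Infinite K] (w : Fin n → ℕ) (hw : ∀ i, w i ≠ 0)
    (f : MvPolynomial (Fin n) K) (b : ℕ) (hf : ∀ t : K, f ∈ RingHom.ker (eval ((fun i => t ^ w i))) ^ b)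
    (hM : ∀ F : MvPolynomial (Fin n) K, monomialCurve w F = 0 → F ∈ idealOfVars (Fin n) K ^ 2) :
    ¬ CampaignW54.RegularEnclosureAt (⟨ofIdealTop ((Ideal.span {f}).map (Scheme.ΓSpecIso (CommRingCat.of (MvPolynomial (Fin n) K))).inv.hom), b⟩ :
      IdealExponent (Spec (CommRingCat.of (MvPolynomial (Fin n) K)))) (⟨RingHom.ker (eval fun i => (0 : K) ^ w i), RingHom.ker_isPrime _⟩ : Spec (CommRingCat.of (MvPolynomial (Fin n) K))) :=
  CampaignW54.not_regularEnclosureAt_of_le_sq (singIdealAt_le_sq w hw f b hf hM)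

/-- **K5.4 kernel instance, witness W5** (`𝔸⁵`, `p = 2`): at the origin of `Spec K[x,y,z,w,v]`, `K` an infinite field
of characteristic `2`, the pair `E = ((fW), 2)`, `fW = x² + wv⁶ + zw⁵v² + yz²wv⁴ + yz³w⁵ + yz⁹ + y⁴zw²v² + y¹¹`, admits
NO regular enclosure: no regular parameter of `𝒪_{Z,0}` vanishes on `Sing(E)` near `0`. [folklore] -/
theorem WQ5.not_regularEnclosureAt (K : Type u) [Field K] [CharP K 2] [Infinite K] :
    ¬ CampaignW54.RegularEnclosureAt (⟨ofIdealTop ((Ideal.span {Hironaka2017.WQWitness.fW (R := K)}).map (Scheme.ΓSpecIso (CommRingCat.of (MvPolynomial (Fin 5) K))).inv.hom), 2⟩ :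
      IdealExponent (Spec (CommRingCat.of (MvPolynomial (Fin 5) K)))) (⟨RingHom.ker (eval fun i => (0 : K) ^ WQ5.w i), RingHom.ker_isPrime _⟩ : Spec (CommRingCat.of (MvPolynomial (Fin 5) K))) :=
  not_regularEnclosureAt_of_curve WQ5.w WQ5.w_ne_zero (Hironaka2017.WQWitness.fW (R := K)) 2
    (WQ5.fW_mem_ker_eval_sq (K := K)) fun _ hF => WQ5.mem_idealOfVars_sq hF

/-- **K5.4 kernel instance, witness W4** (`𝔸⁴`, `p = 3`): at the origin of `Spec K[x,y,z,w]`, `K` an infinite field of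
characteristic `3`, the pair `((x³ + G), 2)` on the W-Q hypersurface of `…Hironaka2017.WQ3Witness` admits NO regular
enclosure: no regular parameter of `𝒪_{Z,0}` vanishes on the multiplicity-`≥ 2` locus of `x³ + G` near `0` (which
contains the curve `γ₄` by the first-order Taylor step; the prior cell's pair carries the exponent `3`, whose singular
locus `{ord ≥ 3} ⊆ {ord ≥ 2}` also contains `γ₄` — job `j258977` row Q2 — but the order-`3` membership needs the
second-order Taylor step, not formalised here). [folklore] -/
theorem WQ4.not_regularEnclosureAt (K : Type u) [Field K] [CharP K 3] [Infinite K] :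
    ¬ CampaignW54.RegularEnclosureAt (⟨ofIdealTop ((Ideal.span {Hironaka2017.WQ3Witness.f (R := K)}).map (Scheme.ΓSpecIso (CommRingCat.of (MvPolynomial (Fin 4) K))).inv.hom), 2⟩ :
      IdealExponent (Spec (CommRingCat.of (MvPolynomial (Fin 4) K)))) (⟨RingHom.ker (eval fun i => (0 : K) ^ WQ4.w i), RingHom.ker_isPrime _⟩ : Spec (CommRingCat.of (MvPolynomial (Fin 4) K))) :=
  not_regularEnclosureAt_of_curve WQ4.w WQ4.w_ne_zero (Hironaka2017.WQ3Witness.f (R := K)) 2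
    (WQ4.f_mem_ker_eval_sq (K := K)) fun _ hF => WQ4.mem_idealOfVars_sq hF

end Assembly

/-! ## §4 The global campaign statement `CampaignW54RegularEnclosure p` is false for `p = 2, 3` -/
section Global

variable (K : Type u) [Field K] {n : ℕ}

/-- `Spec K[x_0, …, x_{n-1}] → Spec K` is smooth (a polynomial algebra is a smooth algebra). [folklore] -/
theorem smooth_affSpec (n : ℕ) :
    Smooth (Spec.map (CommRingCat.ofHom (algebraMap K (MvPolynomial (Fin n) K)))) := by
  rw [HasRingHomProperty.Spec_iff (P := @Smooth)]
  have : Algebra.Smooth K (MvPolynomial (Fin n) K) := {}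
  exact RingHom.smooth_algebraMap.mpr this

variable {K}

/-- The pair `((f), b)` is standard (`(f) ≠ 0`, `b > 0`) for `f ≠ 0`, `b > 0`. [folklore] -/
theorem pairOf_isStandard (f : MvPolynomial (Fin n) K) (hf : f ≠ 0) (b : ℕ) (hb : 0 < b) :
    IdealExponent.IsStandard
      (⟨ofIdealTop ((Ideal.span {f}).map (Scheme.ΓSpecIso (CommRingCat.of (MvPolynomial (Fin n) K))).inv.hom), b⟩ :
      IdealExponent (Spec (CommRingCat.of (MvPolynomial (Fin n) K)))) := by
  refine ⟨fun h => hf ?_, hb⟩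
  set ι := Scheme.ΓSpecIso (CommRingCat.of (MvPolynomial (Fin n) K)) with hι
  have h1 := congrArg (fun J : (Spec (CommRingCat.of (MvPolynomial (Fin n) K))).IdealSheafData => J.ideal ⟨⊤, isAffineOpen_top _⟩) h
  simp only [ofIdealTop_ideal, ideal_bot, Pi.bot_apply] at h1
  have hmem : ((Spec (CommRingCat.of (MvPolynomial (Fin n) K))).presheaf.map (homOfLE (le_top : (⊤ : (Spec (CommRingCat.of (MvPolynomial (Fin n) K))).Opens) ≤ ⊤)).op).hom
      (ι.inv.hom f) ∈ (⊥ : Ideal _) := by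
    rw [← h1]
    exact Ideal.mem_map_of_mem _ (Ideal.mem_map_of_mem _ (Ideal.subset_span rfl))
  rw [Ideal.mem_bot] at hmem
  have hid : (Spec (CommRingCat.of (MvPolynomial (Fin n) K))).presheaf.map (homOfLE (le_top : (⊤ : (Spec (CommRingCat.of (MvPolynomial (Fin n) K))).Opens) ≤ ⊤)).op = 𝟙 _ := by
    have : homOfLE (le_top : (⊤ : (Spec (CommRingCat.of (MvPolynomial (Fin n) K))).Opens) ≤ ⊤) = 𝟙 _ := Subsingleton.elim _ _
    rw [this, op_id, CategoryTheory.Functor.map_id]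
  rw [hid] at hmem
  change ι.inv f = 0 at hmem
  have : ι.hom (ι.inv f) = f := by
    change (ι.inv ≫ ι.hom) f = f
    rw [Iso.inv_hom_id]; rfl
  rw [← this, hmem, map_zero]

/-- The `K`-rational point `γ(t)` is a closed point of `Spec K[x]` (its ideal is maximal: `K[x]/𝔞 ≅ K`). [folklore] -/
theorem curvePoint_mem_closedPoints (w : Fin n → ℕ) (t : K) :
    (⟨RingHom.ker (eval fun i => t ^ w i), RingHom.ker_isPrime _⟩ : Spec (CommRingCat.of (MvPolynomial (Fin n) K))) ∈ Hironaka2017.S02Preliminaries.closedPoints (Spec (CommRingCat.of (MvPolynomial (Fin n) K))) := by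
  change IsClosed ({(⟨RingHom.ker (eval fun i => t ^ w i), RingHom.ker_isPrime _⟩ : PrimeSpectrum (MvPolynomial (Fin n) K))} :
    Set (PrimeSpectrum (MvPolynomial (Fin n) K)))
  exact (PrimeSpectrum.isClosed_singleton_iff_isMaximal _).mpr
    (RingHom.ker_isMaximal_of_surjective (eval ((fun i => t ^ w i))) fun c => ⟨C c, eval_C c⟩)

/-- `fW ≠ 0` (its value at `(1,0,0,0,0)` is `1`). [folklore] -/
theorem WQ5.fW_ne_zero : (Hironaka2017.WQWitness.fW (R := K)) ≠ 0 := by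
  intro h
  have h1 : eval (fun i : Fin 5 => if i = 0 then (1 : K) else 0) (Hironaka2017.WQWitness.fW (R := K)) = 1 := by
    simp [Hironaka2017.WQWitness.fW]
  rw [h, map_zero] at h1
  exact zero_ne_one h1

/-- `x³ + G ≠ 0` (its value at `(1,0,0,0)` is `1`). [folklore] -/
theorem WQ4.f_ne_zero : (Hironaka2017.WQ3Witness.f (R := K)) ≠ 0 := by
  intro h
  have h1 : eval (fun i : Fin 4 => if i = 0 then (1 : K) else 0) (Hironaka2017.WQ3Witness.f (R := K)) = 1 := by
    simp [Hironaka2017.WQ3Witness.f, Hironaka2017.WQ3Witness.G]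
  rw [h, map_zero] at h1
  exact zero_ne_one h1

/-- **`CampaignW54RegularEnclosure 2` is FALSE** (universe `0`): over the perfect infinite field `K = 𝔽̄₂`, the affine
ambient datum `Spec K[x,y,z,w,v]`, the standard pair `E = ((fW), 2)` and the closed point `0 ∈ Sing(E)` give
`¬ RegularEnclosureAt E 0` (`WQ5.not_regularEnclosureAt`). NOT a statement about the manuscript — it refutes the cell's
OURS campaign statement in the deciding reading (W_G) of kill test K5.4. [folklore] -/
theorem not_campaignW54RegularEnclosure_two : ¬ CampaignW54RegularEnclosure.{0} 2 := by
  intro h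
  have h' := h (AlgebraicClosure (ZMod 2)) (⟨Spec (CommRingCat.of (MvPolynomial (Fin 5) (AlgebraicClosure (ZMod 2)))),
      Spec.map (CommRingCat.ofHom (algebraMap (AlgebraicClosure (ZMod 2)) (MvPolynomial (Fin 5) (AlgebraicClosure (ZMod 2))))), inferInstance,
      smooth_affSpec (AlgebraicClosure (ZMod 2)) 5, inferInstance⟩ : AmbientDatum 2 (AlgebraicClosure (ZMod 2)))
    (⟨ofIdealTop ((Ideal.span {Hironaka2017.WQWitness.fW (R := AlgebraicClosure (ZMod 2))}).map (Scheme.ΓSpecIso (CommRingCat.of (MvPolynomial (Fin 5) (AlgebraicClosure (ZMod 2))))).inv.hom), 2⟩ :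
      IdealExponent (Spec (CommRingCat.of (MvPolynomial (Fin 5) (AlgebraicClosure (ZMod 2))))))
    (pairOf_isStandard _ WQ5.fW_ne_zero 2 two_pos) (⟨RingHom.ker (eval fun i => (0 : AlgebraicClosure (ZMod 2)) ^ WQ5.w i), RingHom.ker_isPrime _⟩ : Spec (CommRingCat.of (MvPolynomial (Fin 5) (AlgebraicClosure (ZMod 2)))))
    ⟨curvePoint_mem_sing WQ5.w _ 2 (WQ5.fW_mem_ker_eval_sq (K := AlgebraicClosure (ZMod 2)))
        (0 : AlgebraicClosure (ZMod 2)),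
      curvePoint_mem_closedPoints (K := AlgebraicClosure (ZMod 2)) WQ5.w 0⟩
  exact WQ5.not_regularEnclosureAt (AlgebraicClosure (ZMod 2)) h'

/-- **`CampaignW54RegularEnclosure 3` is FALSE** (universe `0`): over `K = 𝔽̄₃`, `Spec K[x,y,z,w]`, the standard pair
`((x³ + G), 2)` on the W-Q hypersurface of `…WQ3Witness` and the closed point `0` (`WQ4.not_regularEnclosureAt`).
[folklore] -/
theorem not_campaignW54RegularEnclosure_three : ¬ CampaignW54RegularEnclosure.{0} 3 := by
  intro h
  have h' := h (AlgebraicClosure (ZMod 3)) (⟨Spec (CommRingCat.of (MvPolynomial (Fin 4) (AlgebraicClosure (ZMod 3)))),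
      Spec.map (CommRingCat.ofHom (algebraMap (AlgebraicClosure (ZMod 3)) (MvPolynomial (Fin 4) (AlgebraicClosure (ZMod 3))))), inferInstance,
      smooth_affSpec (AlgebraicClosure (ZMod 3)) 4, inferInstance⟩ : AmbientDatum 3 (AlgebraicClosure (ZMod 3)))
    (⟨ofIdealTop ((Ideal.span {Hironaka2017.WQ3Witness.f (R := AlgebraicClosure (ZMod 3))}).map (Scheme.ΓSpecIso (CommRingCat.of (MvPolynomial (Fin 4) (AlgebraicClosure (ZMod 3))))).inv.hom), 2⟩ :
      IdealExponent (Spec (CommRingCat.of (MvPolynomial (Fin 4) (AlgebraicClosure (ZMod 3))))))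
    (pairOf_isStandard _ WQ4.f_ne_zero 2 two_pos) (⟨RingHom.ker (eval fun i => (0 : AlgebraicClosure (ZMod 3)) ^ WQ4.w i), RingHom.ker_isPrime _⟩ : Spec (CommRingCat.of (MvPolynomial (Fin 4) (AlgebraicClosure (ZMod 3)))))
    ⟨curvePoint_mem_sing WQ4.w _ 2 (WQ4.f_mem_ker_eval_sq (K := AlgebraicClosure (ZMod 3)))
        (0 : AlgebraicClosure (ZMod 3)),
      curvePoint_mem_closedPoints (K := AlgebraicClosure (ZMod 3)) WQ4.w 0⟩
  exact WQ4.not_regularEnclosureAt (AlgebraicClosure (ZMod 3)) h'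

end Global

end K54WQRefutation

end Summit.ResolutionOfSingularities.ResolutionOfSingularities.Theorems

end
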